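/-
Copyright (c) 2026 the pub-hodgecm-mathlib formalisation cell (harness21).  Prover seat hodgecm-mathlib-LH4-p17 (g2) (Track A hand lent to L1 by the
chair's VALVE), Track B «K2-LIT» ∕ hLiu418 #184♮ = `stmt-HodgeConjecture-24832`, socket #41, road (R-c) of RULING «M-158j»: THE LEVI LETTER `hΛK` AT THE
DATUM OF RECORD (desk K2Liu-p25 (g2) 2026-09-04T22:54:52Z (ii) GO; LEAD F0P6-plan (g14) BATCH #82 (3) ∕ #98 (4)).  THEOREMS ONLY (no `def`, no instance,
no notation, no named-fact hypothesis, no `sorry`).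
-/
import Summits.HodgeConjecture.HodgeConjecture.Theorems.K2LiuIwasawaDatumOfRecordFrame       -- ★ `exists_isStd_frame` (the datum of record + its adelic frame)
import Summits.HodgeConjecture.HodgeConjecture.Theorems.K2LiuIwasawaHeightArchReduction     -- ★ `archEmb_archPart_mem` (§2, arch half)
import Summits.HodgeConjecture.HodgeConjecture.Theorems.K2LiuSiegelDoubledLeviMatrix         -- ★ `exists_leviHom` (the chart's block shape; `cayR`, `cayRinv`, `Invertible (2 : 𝔸_L)`)
import HarnessLib

/-!
# Crux `HLiu418`, socket #41, road (R-c): THE TREE'S STANDARD IWASAWA DATUM IS LEVI-ADAPTED — `Λ(K_{GL_n}) ⊆ K₉` for every Siegel–Levi chart `Λ`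
# of record (`hΛK` at the datum of record, BOTH the archimedean and the finite half)

Cell `hodgecm-mathlib`, crux item hLiu418 = `stmt-HodgeConjecture-24832`; squad K2 ∕ K2Liu (L1, LEAD F0P6-plan (g14)); desk K2Liu-p25 (g2); prover
LH4-p17 (g2) (valve hand).  THEOREMS ONLY; lane `--supports stmt-HodgeConjecture-24832 --as helper` (count-neutral; closes no socket by itself).

WHY (RULING «M-158j», road (R-c); LEAD BATCH #70 (1), #110 (4); desk K2Liu-p25 22:35:26Z ∕ 22:51:45Z ∕ 22:54:52Z).  Socket #41 ranges over every STANDARD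
Iwasawa datum; the middle-term organ ★ I4 ED. 5 `K2LiuSiegelEisensteinMiddleTermOfStandardLevel` carries the Levi letter `hΛK : ∀ k ∈ KG, Λ k ∈ 𝒦.K` for a
level `KG ≤ K_{GL₂}` OPEN OF FINITE INDEX; the END composition ★ `K2LiuSiegelEisensteinArchClassTransport.continuation_of_archReference (𝒦₁)` (K2Liu-p25,
over ★ (T) p862487, ★ p862582, ★ §5 p862557 and ★ (T3-arch) p862756 `K2LiuArchMajorantTransitivity`) reduces #41 at an arbitrary standard datum to #41 at the
standard data whose ARCHIMEDEAN compact is that of ONE reference datum `𝒦₁`.  What the reference must supply is the archimedean half of `hΛK` — at `∞` an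
open finite-index subgroup of the connected `K_∞ = ∏_w U(n)` is all of `K_∞`, so `Λ(K_∞) ⊆ (𝒦₁)_∞` is forced.  THIS FILE proves it for the tree's own datum `K₉`
(★ `K2LiuIwasawaDatumNonempty` ∕ ★ `K2LiuIwasawaDatumNonemptyStd`, frame by value ★ `K2LiuIwasawaDatumOfRecordFrame`: `K₉ = S·(K_∞·GL_{2n}(𝒪̂_L))·S⁻¹ ∩ H(𝔸)`,
`S = R·diag(1, ½T⁻¹w)`, `R = cayR = [[1,1],[1,−1]]`, `w = antidiag(1,…,1)`), in fact the FULL letter `Λ(K_{GL_n}) ⊆ K₉` for every homomorphism `Λ` with the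
Siegel–Levi block shape of record `blk (Λ g) = R·[[g, 0],[0, T⁻¹σ(g⁻¹)ᵀT]]·R⁻¹` (★ `K2LiuSiegelDoubledLeviMatrix.exists_leviHom`, ★ α3-2's `hΛ`, I4 ED. 5's binder).
THE COMPUTATION (place-free): `S⁻¹ (Λ g) S = diag(g, w·σ(g⁻¹)ᵀ·w)` — the Gram matrix `T` CANCELS — and for `k ∈ K_{GL_n} = K_∞·GL_n(𝒪̂_L)`
(★ `mem_standardMaximalCompactGL_iff_toMixed_sndHom`) both blocks lie in `K_{GL_{2n}}`: at `∞` from `k_∞^{σT}k_∞ = 1` (★ `mem_Kinf_iff_mem_arch_one`), at the finite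
places from the integrality of `k_f^{±1}` (★ `mem_glFiniteIntegralLevel_iff`; `w` has entries `0, 1`; `σ = c ⊗ 1` preserves `𝒪̂_L`).  (T3-fin) «≠» of BATCH #70 concerns
ARBITRARY open finite parts; the reference `K₉` itself is Levi-adapted at every place, and the `P_Δ`-conjugate data of ★ p862756 §4 still take (R-a)'s preimage
levels at the finite places (★ I3 ED. 2 ∕ I4 ED. 5), as booked.
* §1 ring lemmas: `Sinv_mul_leviBlk_mul_S` (`S⁻¹·(R·[[g,0],[0,M]]·R⁻¹)·S = [[g,0],[0,(Y+Y)·M·X]]`), `gram_cancel`, `unitary_leviBlock`, entry-integrality helpers,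
  `conjFiniteAdele_mem_integralFiniteAdeles`.
* §2 HEAD **`exists_isStd_leviAdapted`** — `∃ 𝒦, 𝒦.IsStd ∧ ∀ Λ (hΛ : Siegel–Levi block shape) (k ∈ K_{GL_n}), Λ k ∈ 𝒦.K`; and **`exists_isStd_leviAdapted_arch`** —
  the same with `(Λ(k)_∞, 1) ∈ 𝒦.K` added (★ `archEmb_archPart_mem`): the letter `continuation_of_archReference (𝒦₁ := K₉)` consumes.
HONEST LABEL.  Count-neutral helper: `HC_CM` is proved only modulo the 7 printed citations (2 remaining named inputs: hLiu418 =
`stmt-HodgeConjecture-24832`, h413 = `stmt-HodgeConjecture-24833`) until rung 0 closes; this file closes no socket.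

## References
* [HarrisKudlaSweet1996] M. Harris, S. S. Kudla, W. J. Sweet, J. Amer. Math. Soc. 9 (1996), §1 (1.11)–(1.12) (the Siegel Levi `m(a) = (a, ǎ)`, the frame `R`).
* [Tan1999] V. Tan, *Poles of Siegel Eisenstein series on U(n,n)*, Canad. J. Math. 51 (1999), §1 p. 166 (`K = K_∞ ∏ K_v`; `m(A) ∈ K` for `A ∈ K_{GL_n}`).
* [BorelJacquet1979] A. Borel, H. Jacquet, PSPM 33.1 (1979), §4.1 (`G(𝔸) = G_∞ × G(𝔸_f)`, `K`-finiteness).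
* [Weil1964] A. Weil, Acta Math. 111 (1964), Chap. I n° 8 (majorants).
-/

set_option autoImplicit false
set_option linter.dupNamespace false -- the mandated namespace repeats `HodgeConjecture.HodgeConjecture`

noncomputable section

open scoped Matrix
open NumberField IsDedekindDomain NumberField.InfinitePlace NumberField.mixedEmbedding

namespace Summit.HodgeConjecture.HodgeConjecture.Cruxes.HLiu418.K2LiuLeviChartArchCompactOfRecord

open Literature.NumberTheory.Automorphic Literature.NumberTheory.Automorphic.UnitaryGroup
open Literature.NumberTheory.GelbartRogawski1991 Literature.NumberTheory.GelbartRogawski1991.GRConstruction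
open Literature.NumberTheory.GelbartRogawski1991.AdaptedBlocks
open Literature.NumberTheory.K2Lit.SiegelDoubled
open Summit.HodgeConjecture.HodgeConjecture.Cruxes.HLiu418.K2LiuSiegelDoubledIwasawaCompact
open Summit.HodgeConjecture.HodgeConjecture.Cruxes.HLiu418.K2LiuIwasawaDatumNonemptyStd
open Summit.HodgeConjecture.HodgeConjecture.Cruxes.HLiu418.K2LiuIwasawaDatumOfRecordFrame (exists_isStd_frame)
open Summit.HodgeConjecture.HodgeConjecture.Cruxes.HLiu418.K2LiuArchOneParameterOrbitDefs (archEmb_eq_archToAdelic)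
open Summit.HodgeConjecture.HodgeConjecture.Cruxes.HLiu418.K2LiuIwasawaHeightArchReduction (archEmb_archPart_mem)

/-! ## §1 The Levi block in the frame `S = R·diag(1, X)`; `σ` preserves the integral finite adeles -/

section Ring

variable {R : Type*} [CommRing R] [Invertible (2 : R)] {ι : Type*} [Fintype ι] [DecidableEq ι]

/-- **`S⁻¹ · (R·[[g, 0],[0, M]]·R⁻¹) · S = [[g, 0],[0, (Y + Y)·M·X]]`** for the frame `S = [[1, X],[1, −X]] = R·diag(1, X)` with inverse `S⁻¹ = [[a, a],[Y, −Y]]`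
(`a + a = 1`; `R = cayR = [[1,1],[1,−1]]`, `R⁻¹ = ½R`): `S⁻¹R = diag(1, Y + Y)` and `R⁻¹S = diag(1, X)`. [cite: HarrisKudlaSweet1996, §1 (1.11)] -/
theorem Sinv_mul_leviBlk_mul_S (a : R) (ha : a + a = 1) (g M X Y : Matrix ι ι R) :
    Matrix.fromBlocks (a • (1 : Matrix ι ι R)) (a • (1 : Matrix ι ι R)) Y (-Y) *
        (cayR R ι * Matrix.fromBlocks g 0 0 M * cayRinv R ι) * Matrix.fromBlocks (1 : Matrix ι ι R) X 1 (-X) =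
      Matrix.fromBlocks g 0 0 ((Y + Y) * M * X) := by
  have h1 : Matrix.fromBlocks (a • (1 : Matrix ι ι R)) (a • (1 : Matrix ι ι R)) Y (-Y) * cayR R ι = Matrix.fromBlocks 1 0 0 (Y + Y) := by
    rw [cayR, Matrix.fromBlocks_multiply]
    simp only [Matrix.mul_one, Matrix.mul_neg, neg_neg, ← add_smul, ha, one_smul, add_neg_cancel]
  have h2 : cayRinv R ι * Matrix.fromBlocks (1 : Matrix ι ι R) X 1 (-X) = Matrix.fromBlocks 1 0 0 X := by
    rw [cayRinv, cayR, Matrix.smul_mul, Matrix.fromBlocks_multiply, Matrix.fromBlocks_smul]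
    simp only [Matrix.neg_mul, one_mul, neg_neg, add_neg_cancel, smul_zero]
    have h2' : ⅟(2 : R) • ((1 : Matrix ι ι R) + 1) = 1 := by
      rw [← two_smul R (1 : Matrix ι ι R), smul_smul, invOf_mul_self, one_smul]
    have h2'' : ⅟(2 : R) • (X + X) = X := by
      rw [← two_smul R X, smul_smul, invOf_mul_self, one_smul]
    rw [h2', h2'']
  calc Matrix.fromBlocks (a • (1 : Matrix ι ι R)) (a • (1 : Matrix ι ι R)) Y (-Y) *
        (cayR R ι * Matrix.fromBlocks g 0 0 M * cayRinv R ι) * Matrix.fromBlocks (1 : Matrix ι ι R) X 1 (-X)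
      = (Matrix.fromBlocks (a • (1 : Matrix ι ι R)) (a • (1 : Matrix ι ι R)) Y (-Y) * cayR R ι) * Matrix.fromBlocks g 0 0 M *
          (cayRinv R ι * Matrix.fromBlocks (1 : Matrix ι ι R) X 1 (-X)) := by
        simp only [Matrix.mul_assoc]
    _ = Matrix.fromBlocks g 0 0 ((Y + Y) * M * X) := by
        rw [h1, h2, Matrix.fromBlocks_multiply, Matrix.fromBlocks_multiply]
        simp only [Matrix.one_mul, Matrix.mul_one, Matrix.zero_mul, Matrix.mul_zero, add_zero, zero_add]

omit [Invertible (2 : R)] in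
/-- **THE GRAM MATRIX CANCELS**: `(wT + wT)·(T⁻¹·M·T)·(a·(T⁻¹w)) = w·M·w` for `T⁻¹T = TT⁻¹ = 1` and `a + a = 1` (the lower Levi block in the frame
`S = R·diag(1, ½T⁻¹w)`). [cite: HarrisKudlaSweet1996, §1 (1.11)] -/
theorem gram_cancel (a : R) (ha : a + a = 1) (T Ti w M : Matrix ι ι R) (hTi' : T * Ti = 1) :
    (w * T + w * T) * (Ti * M * T) * (a • (Ti * w)) = w * M * w := by
  have h1 : (w * T + w * T) * (Ti * M * T) = (w + w) * M * T := by
    rw [← add_mul]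
    calc (w + w) * T * (Ti * M * T) = (w + w) * (T * Ti) * M * T := by simp only [Matrix.mul_assoc]
      _ = (w + w) * M * T := by rw [hTi', Matrix.mul_one]
  rw [h1, Matrix.mul_smul]
  calc a • ((w + w) * M * T * (Ti * w)) = a • ((w + w) * M * (T * Ti) * w) := by simp only [Matrix.mul_assoc]
    _ = a • ((w + w) * M * w) := by rw [hTi', Matrix.mul_one]
    _ = (a * 2) • (w * M * w) := by rw [add_mul, add_mul, ← two_smul R (w * M * w), smul_smul]
    _ = w * M * w := by rw [mul_two, ha, one_smul]

omit [Invertible (2 : R)] in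
/-- **THE TRANSPORTED LEVI ELEMENT IS UNITARY** (archimedean half): for an involution `τ`, `k` with two-sided inverse `ki` and `τ(k)ᵀ k = 1`, and a symmetric
`τ`-fixed involution `w`: the block matrix `diag(k, w·τ(ki)ᵀ·w)` satisfies `τ(·)ᵀ · (·) = 1` (`τ(ki)ᵀ = k`, `w τ(k)ᵀ w · w k w = w (τ(k)ᵀ k) w = 1`).
[cite: Tan1999, §1 p. 166] [cite: BorelJacquet1979, §4.1] -/
theorem unitary_leviBlock {S : Type*} [CommRing S] (τ : S →+* S) (hτ : ∀ x, τ (τ x) = x) (k ki w : Matrix ι ι S)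
    (hkki : k * ki = 1) (hU : (k.map τ)ᵀ * k = 1) (hww : w * w = 1) (hwT : wᵀ = w) (hwτ : w.map τ = w) :
    ((Matrix.fromBlocks k 0 0 (w * (ki.map τ)ᵀ * w)).map τ)ᵀ * Matrix.fromBlocks k 0 0 (w * (ki.map τ)ᵀ * w) = 1 := by
  have hmapmap : ∀ A : Matrix ι ι S, (A.map τ).map τ = A := fun A => by
    ext i j
    simp only [Matrix.map_apply, hτ]
  have hki : ki = (k.map τ)ᵀ := by
    calc ki = (k.map τ)ᵀ * k * ki := by rw [hU, Matrix.one_mul]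
      _ = (k.map τ)ᵀ := by rw [Matrix.mul_assoc, hkki, Matrix.mul_one]
  have hkiτ : (ki.map τ)ᵀ = k := by
    rw [hki, Matrix.transpose_map, Matrix.transpose_transpose, hmapmap]
  rw [hkiτ, Matrix.fromBlocks_map, Matrix.fromBlocks_transpose, Matrix.fromBlocks_multiply, Matrix.map_zero τ (map_zero τ),
    Matrix.transpose_zero, Matrix.map_mul, Matrix.map_mul, hwτ, Matrix.transpose_mul, Matrix.transpose_mul, hwT, hU, ← Matrix.fromBlocks_one]
  simp only [Matrix.zero_mul, Matrix.mul_zero, add_zero, zero_add]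
  congr 1
  calc w * ((k.map τ)ᵀ * w) * (w * k * w) = w * (k.map τ)ᵀ * (w * w) * k * w := by simp only [Matrix.mul_assoc]
    _ = 1 := by rw [hww, Matrix.mul_one, Matrix.mul_assoc w, hU, Matrix.mul_one, hww]

omit [Invertible (2 : R)] [Fintype ι] [DecidableEq ι] in
/-- entries of a re-indexed block-diagonal matrix lie in a subring when the entries of the two blocks do. [folklore] -/
theorem reindex_fromBlocks_apply_mem {S : Type*} [CommRing S] (O : Subring S) {m : Type*} (eq : ι ⊕ ι ≃ m) {A D : Matrix ι ι S}
    (hA : ∀ i j, A i j ∈ O) (hD : ∀ i j, D i j ∈ O) (i j : m) : Matrix.reindex eq eq (Matrix.fromBlocks A 0 0 D) i j ∈ O := by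
  rw [Matrix.reindex_apply, Matrix.submatrix_apply]
  rcases eq.symm i with a | a <;> rcases eq.symm j with b | b
  · rw [Matrix.fromBlocks_apply₁₁]; exact hA a b
  · rw [Matrix.fromBlocks_apply₁₂]; exact O.zero_mem
  · rw [Matrix.fromBlocks_apply₂₁]; exact O.zero_mem
  · rw [Matrix.fromBlocks_apply₂₂]; exact hD a b

omit [Invertible (2 : R)] in
/-- entries of `w·Bᵀ·w` lie in a subring when those of `w` and `B` do (`Subring.matrix`). [folklore] -/
theorem mul_transpose_mul_apply_mem {S : Type*} [CommRing S] (O : Subring S) {w B : Matrix ι ι S}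
    (hw : ∀ i j, w i j ∈ O) (hB : ∀ i j, B i j ∈ O) : ∀ i j, (w * Bᵀ * w) i j ∈ O := by
  have hw' : w ∈ (O.matrix : Subring (Matrix ι ι S)) := hw
  have hB' : Bᵀ ∈ (O.matrix : Subring (Matrix ι ι S)) := fun i j => hB j i
  exact (O.matrix : Subring (Matrix ι ι S)).mul_mem ((O.matrix : Subring (Matrix ι ι S)).mul_mem hw' hB') hw'

omit [Invertible (2 : R)] in
/-- `τ(·)ᵀ·(·) = 1` passes through re-indexing along an equivalence. [folklore] -/
theorem transpose_map_mul_reindex_eq_one {S : Type*} [CommRing S] (τ : S →+* S) {m : Type*} [Fintype m] [DecidableEq m] (eq : ι ⊕ ι ≃ m)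
    (A : Matrix (ι ⊕ ι) (ι ⊕ ι) S) (h : (A.map τ)ᵀ * A = 1) : ((Matrix.reindex eq eq A).map τ)ᵀ * Matrix.reindex eq eq A = 1 := by
  rw [Matrix.reindex_apply, ← Matrix.submatrix_map, Matrix.transpose_submatrix, Matrix.submatrix_mul_equiv, h, Matrix.submatrix_one_equiv]

end Ring

/-- **`σ = c ⊗ 1` preserves the integral finite adeles** (componentwise: `(σx)_w = σ_*(x_{σ⁻¹w})` and `σ_*` respects integrality,
★ `galAdicCompletionMap_mem_adicCompletionIntegers_iff`). [cite: BorelJacquet1979, §4.1] -/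
theorem conjFiniteAdele_mem_integralFiniteAdeles (F : Type) {E : Type} [Field F] [Field E] [NumberField E] [Algebra F E] (c : E ≃ₐ[F] E)
    {x : FiniteAdeleRing (𝓞 E) E} (hx : x ∈ integralFiniteAdeles E) : conjFiniteAdele F E c x ∈ integralFiniteAdeles E := by
  rw [mem_integralFiniteAdeles_iff] at hx ⊢
  intro w
  rw [conjFiniteAdele_apply_apply, galAdicCompletionMap_mem_adicCompletionIntegers_iff]
  exact hx _

/-! ## §2 HEAD — the datum of record is Levi-adapted: `Λ(K_{GL_n}) ⊆ K₉` -/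

section Transport

open UnitaryDualPair

variable (L : Type) [Field L] [NumberField L] [IsCMField L]
variable {N M n : ℕ} (e : Fin N × Fin M ≃ Fin n)
  (dV : Fin N → L) (hdV : ∀ i, IsCMField.complexConj L (dV i) = dV i)
  (dW : Fin M → L) (hdW : ∀ i, IsCMField.complexConj L (dW i) = dW i)

/-- **THE DATUM OF RECORD IS LEVI-ADAPTED (`hΛK` in full, archimedean AND finite).**  There is a STANDARD Iwasawa datum `𝒦` of the doubled group (the tree's
`K₉`, with its adelic frame `S_𝔸` from ★ `K2LiuIwasawaDatumOfRecordFrame.exists_isStd_frame`) such that for EVERY homomorphism `Λ : GL_n(𝔸_L) →* H(𝔸)` with the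
Siegel–Levi block shape of record `blk (Λ g) = R·[[g, 0],[0, T⁻¹σ(g⁻¹)ᵀT]]·R⁻¹` (★ `K2LiuSiegelDoubledLeviMatrix.exists_leviHom`; the `hΛ` binder of ★ α3-2 ∕ ★ I4 ED. 5)
and every `k ∈ K_{GL_n} = standardMaximalCompactGL n L`: `Λ k ∈ 𝒦.K`.  PROOF: `S_𝔸⁻¹ (Λ k) S_𝔸 = diag(k, w·σ(k⁻¹)ᵀ·w)` (§1 `Sinv_mul_leviBlk_mul_S` + `gram_cancel`:
the Gram matrix cancels), whose archimedean component is unitary (`unitary_leviBlock` at `τ = c ⊗ 1`, `k_∞^{σT}k_∞ = 1` by ★ `mem_Kinf_iff_mem_arch_one`) and whose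
finite component and its inverse (`= S_𝔸⁻¹ Λ(k⁻¹) S_𝔸`) have entries in `𝒪̂_L` (`k_f^{±1}` integral, `w ∈ M_n({0,1})`, `conjFiniteAdele_mem_integralFiniteAdeles`);
★ `mem_standardMaximalCompactGL_iff_toMixed_sndHom`, ★ `mem_glFiniteIntegralLevel_iff`. [cite: Tan1999, §1 p. 166] [cite: HarrisKudlaSweet1996, §1 (1.11)]
[cite: BorelJacquet1979, §4.1] -/
theorem exists_isStd_leviAdapted (hdV0 : ∀ i, dV i ≠ 0) (hdW0 : ∀ i, dW i ≠ 0) :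
    ∃ 𝒦 : IwasawaDatum L e dV hdV dW hdW, 𝒦.IsStd ∧
      ∀ (Λ : GL (Fin n) (AdeleRing (𝓞 L) L) →* HA L e dV hdV dW hdW)
        (_hΛ : ∀ g : GL (Fin n) (AdeleRing (𝓞 L) L), blk L e dV hdV dW hdW (Λ g) =
          cayR (AdeleRing (𝓞 L) L) (Fin n) * Matrix.fromBlocks (g : Matrix (Fin n) (Fin n) (AdeleRing (𝓞 L) L)) 0 0
            (((gramR L e dV hdV dW hdW).map ((algebraMap L (AdeleRing (𝓞 L) L)).comp (algebraMap (Fp L) L)))⁻¹ *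
              (((g⁻¹ : GL (Fin n) (AdeleRing (𝓞 L) L)) : Matrix (Fin n) (Fin n) (AdeleRing (𝓞 L) L)).map
                (conjAdele (Fp L) L (IsCMField.complexConj L)))ᵀ *
              (gramR L e dV hdV dW hdW).map ((algebraMap L (AdeleRing (𝓞 L) L)).comp (algebraMap (Fp L) L))) *
            cayRinv (AdeleRing (𝓞 L) L) (Fin n))
        (k : GL (Fin n) (AdeleRing (𝓞 L) L)), k ∈ standardMaximalCompactGL n L → Λ k ∈ 𝒦.K := by
  classical
  obtain ⟨𝒦, SA, h𝒦, hmem, hSv, hSi⟩ := exists_isStd_frame L e dV hdV dW hdW hdV0 hdW0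
  refine ⟨𝒦, h𝒦, fun Λ hΛ k hk => ?_⟩
  rw [hmem]
  -- the data over `L⁺` of the construction (★ `exists_isStd_frame`, same letters)
  set T : Matrix (Fin n) (Fin n) (Fp L) := gramR L e dV hdV dW hdW with hTdef
  set w : Matrix (Fin n) (Fin n) (Fp L) := (StdForm.antidiagonal n).over (Fp L) with hwdef
  have hTd : IsUnit T.det := isUnit_det_gramR₀ L e dV hdV hdV0 dW hdW hdW0
  have hws : w.IsSymm := (StdForm.antidiagonal n).transpose_over (Fp L)
  have hww : w * w = 1 := (StdForm.antidiagonal n).over_mul_over (Fp L)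
  set a : Fp L := (2 : Fp L)⁻¹ with hadef
  have ha : a + a = 1 := by rw [hadef, ← two_mul, mul_inv_cancel₀ (two_ne_zero' (Fp L))]
  set X : Matrix (Fin n) (Fin n) (Fp L) := a • (T⁻¹ * w) with hXdef
  set Y : Matrix (Fin n) (Fin n) (Fp L) := w * T with hYdef
  set f : Fp L →+* AdeleRing (𝓞 L) L := (algebraMap L (AdeleRing (𝓞 L) L)).comp (algebraMap (Fp L) L) with hfdef
  have hc1 : IsCMField.complexConj L ≠ 1 := IsCMField.complexConj_ne_one L
  have hfix1 : ∀ w : InfinitePlace L, IsCMField.complexConj L • w = w := complexConj_smul_infinitePlace L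
  set σ : AdeleRing (𝓞 L) L →+* AdeleRing (𝓞 L) L := conjAdele (Fp L) L (IsCMField.complexConj L) with hσdef
  set Tf : Matrix (Fin n) (Fin n) (AdeleRing (𝓞 L) L) := T.map f with hTfdef
  set wf : Matrix (Fin n) (Fin n) (AdeleRing (𝓞 L) L) := w.map f with hwfdef
  have ha' : f a + f a = 1 := by rw [← map_add, ha, map_one]
  have hTi' : Tf * (T⁻¹).map f = 1 := by
    rw [hTfdef, ← Matrix.map_mul, Matrix.mul_nonsing_inv T hTd, Matrix.map_one f (map_zero f) (map_one f)]
  have hTi : (T⁻¹).map f * Tf = 1 := by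
    rw [hTfdef, ← Matrix.map_mul, Matrix.nonsing_inv_mul T hTd, Matrix.map_one f (map_zero f) (map_one f)]
  have hTinv : Tf⁻¹ = (T⁻¹).map f := Matrix.inv_eq_left_inv hTi
  have hwwf : wf * wf = 1 := by rw [hwfdef, ← Matrix.map_mul, hww, Matrix.map_one f (map_zero f) (map_one f)]
  have hwfT : wfᵀ = wf := by rw [hwfdef, ← Matrix.transpose_map, hws.eq]
  have hwfσ : wf.map σ = wf := by
    rw [hwfdef, Matrix.map_map]
    congr 1
    funext x
    exact conjAdele_algebraMap_algebraMap L x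
  -- the matrix of `S⁻¹ (Λ k′) S` for every `k′`
  have hGmat : ∀ k' : GL (Fin n) (AdeleRing (𝓞 L) L),
      ((SA⁻¹ * adelicVal (Fp L) L (IsCMField.complexConj L) (n + n) (hermD L e dV hdV dW hdW) (Λ k') * SA :
          GL (Fin (n + n)) (AdeleRing (𝓞 L) L)) : Matrix (Fin (n + n)) (Fin (n + n)) (AdeleRing (𝓞 L) L)) =
        Matrix.reindex (e₂ (n := n)) (e₂ (n := n))
          (Matrix.fromBlocks (k' : Matrix (Fin n) (Fin n) (AdeleRing (𝓞 L) L)) 0 0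
            (wf * ((((k'⁻¹ : GL (Fin n) (AdeleRing (𝓞 L) L)) : Matrix (Fin n) (Fin n) (AdeleRing (𝓞 L) L)).map σ))ᵀ * wf)) := by
    intro k'
    have hcoe : ((SA⁻¹ * adelicVal (Fp L) L (IsCMField.complexConj L) (n + n) (hermD L e dV hdV dW hdW) (Λ k') * SA :
          GL (Fin (n + n)) (AdeleRing (𝓞 L) L)) : Matrix (Fin (n + n)) (Fin (n + n)) (AdeleRing (𝓞 L) L)) =
        ((SA⁻¹ : GL (Fin (n + n)) (AdeleRing (𝓞 L) L)) : Matrix (Fin (n + n)) (Fin (n + n)) (AdeleRing (𝓞 L) L)) *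
          ((adelicVal (Fp L) L (IsCMField.complexConj L) (n + n) (hermD L e dV hdV dW hdW) (Λ k') :
            GL (Fin (n + n)) (AdeleRing (𝓞 L) L)) : Matrix (Fin (n + n)) (Fin (n + n)) (AdeleRing (𝓞 L) L)) *
          (SA : Matrix (Fin (n + n)) (Fin (n + n)) (AdeleRing (𝓞 L) L)) := rfl
    have hb : Matrix.reindex (e₂ (n := n)).symm (e₂ (n := n)).symm
        ((adelicVal (Fp L) L (IsCMField.complexConj L) (n + n) (hermD L e dV hdV dW hdW) (Λ k') :
          GL (Fin (n + n)) (AdeleRing (𝓞 L) L)) : Matrix (Fin (n + n)) (Fin (n + n)) (AdeleRing (𝓞 L) L)) =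
        cayR (AdeleRing (𝓞 L) L) (Fin n) * Matrix.fromBlocks (k' : Matrix (Fin n) (Fin n) (AdeleRing (𝓞 L) L)) 0 0
          (Tf⁻¹ * ((((k'⁻¹ : GL (Fin n) (AdeleRing (𝓞 L) L)) : Matrix (Fin n) (Fin n) (AdeleRing (𝓞 L) L)).map σ))ᵀ * Tf) *
          cayRinv (AdeleRing (𝓞 L) L) (Fin n) := hΛ k'
    have hA1 : (a • (1 : Matrix (Fin n) (Fin n) (Fp L))).map f = f a • (1 : Matrix (Fin n) (Fin n) (AdeleRing (𝓞 L) L)) := by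
      ext i j
      by_cases hij : i = j
      · subst hij
        simp only [Matrix.map_apply, Matrix.smul_apply, Matrix.one_apply_eq, smul_eq_mul, mul_one]
      · simp only [Matrix.map_apply, Matrix.smul_apply, Matrix.one_apply_ne hij, smul_eq_mul, mul_zero, map_zero]
    have hYf : Y.map f = wf * Tf := by rw [hYdef, Matrix.map_mul]
    have hXf : X.map f = f a • ((T⁻¹).map f * wf) := by
      rw [hXdef, ← Matrix.map_mul]
      ext i j
      simp only [Matrix.map_apply, Matrix.smul_apply, smul_eq_mul, map_mul]
    have key : Matrix.reindex (e₂ (n := n)).symm (e₂ (n := n)).symm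
        ((SA⁻¹ * adelicVal (Fp L) L (IsCMField.complexConj L) (n + n) (hermD L e dV hdV dW hdW) (Λ k') * SA :
          GL (Fin (n + n)) (AdeleRing (𝓞 L) L)) : Matrix (Fin (n + n)) (Fin (n + n)) (AdeleRing (𝓞 L) L)) =
        Matrix.fromBlocks (k' : Matrix (Fin n) (Fin n) (AdeleRing (𝓞 L) L)) 0 0
          (wf * ((((k'⁻¹ : GL (Fin n) (AdeleRing (𝓞 L) L)) : Matrix (Fin n) (Fin n) (AdeleRing (𝓞 L) L)).map σ))ᵀ * wf) := by
      rw [hcoe, reindex_symm_mul_mul, hSi, hb, hSv, hA1, Sinv_mul_leviBlk_mul_S (f a) ha', hYf, hXf, hTinv,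
        gram_cancel (f a) ha' Tf ((T⁻¹).map f) wf _ hTi']
    rw [← key, Matrix.reindex_apply, Matrix.reindex_apply, Matrix.submatrix_submatrix, Equiv.symm_symm, Equiv.self_comp_symm,
      Matrix.submatrix_id_id]
  have hc2 : ∀ x : L, IsCMField.complexConj L (IsCMField.complexConj L x) = x := IsCMField.complexConj_apply_apply L
  rw [mem_standardMaximalCompactGL_iff_toMixed_sndHom]
  refine ⟨?_, ?_⟩
  · -- ARCHIMEDEAN: `(S⁻¹ Λ(k) S)_∞ ∈ K_∞ = U(1)(L ⊗ ℝ)`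
    set φ : AdeleRing (𝓞 L) L →+* mixedSpace L := (InfiniteAdeleRing.ringEquiv_mixedSpace L).toRingHom.comp (adeleFst L) with hφ
    have hconj : ∀ A : Matrix (Fin n) (Fin n) (AdeleRing (𝓞 L) L),
        (A.map φ).map (UnitaryGroup.conjMixed (Fp L) L (IsCMField.complexConj L)) = (A.map σ).map φ := by
      intro A
      rw [Matrix.map_map, Matrix.map_map]
      congr 1
      funext x
      change UnitaryGroup.conjMixed (Fp L) L (IsCMField.complexConj L) (InfiniteAdeleRing.ringEquiv_mixedSpace L x.1) =
        InfiniteAdeleRing.ringEquiv_mixedSpace L (IsCMField.complexConj L • x.1)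
      apply (InfiniteAdeleRing.ringEquiv_mixedSpace L).symm.injective
      rw [ringEquiv_symm_conjMixed, RingEquiv.symm_apply_apply, RingEquiv.symm_apply_apply]
    have hτ : ∀ x, UnitaryGroup.conjMixed (Fp L) L (IsCMField.complexConj L) (UnitaryGroup.conjMixed (Fp L) L (IsCMField.complexConj L) x) = x := by
      intro x
      have hcc : IsCMField.complexConj L * IsCMField.complexConj L = 1 := AlgEquiv.ext fun y => by
        rw [AlgEquiv.mul_apply, AlgEquiv.one_apply]
        exact hc2 y
      have hinv : (IsCMField.complexConj L)⁻¹ = IsCMField.complexConj L := inv_eq_of_mul_eq_one_right hcc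
      have h := UnitaryGroup.conjMixed_inv_apply (Fp L) L (IsCMField.complexConj L) x
      rwa [hinv] at h
    -- the letters of `unitary_leviBlock` at `k_∞`
    have hk1 : ((k : Matrix (Fin n) (Fin n) (AdeleRing (𝓞 L) L)).map φ) *
        ((((k⁻¹ : GL (Fin n) (AdeleRing (𝓞 L) L)) : Matrix (Fin n) (Fin n) (AdeleRing (𝓞 L) L)).map φ)) = 1 := by
      rw [← Matrix.map_mul, ← Units.val_mul, mul_inv_cancel, Units.val_one, Matrix.map_one φ (map_zero φ) (map_one φ)]
    have hU : (((k : Matrix (Fin n) (Fin n) (AdeleRing (𝓞 L) L)).map φ).map (UnitaryGroup.conjMixed (Fp L) L (IsCMField.complexConj L)))ᵀ *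
        (k : Matrix (Fin n) (Fin n) (AdeleRing (𝓞 L) L)).map φ = 1 := by
      have h1 := ((mem_standardMaximalCompactGL_iff_toMixed_sndHom k).1 hk).1
      rw [mem_Kinf_iff_mem_arch_one (Fp L) (IsCMField.complexConj L) hc1 hfix1, mem_arch_iff, UnitaryGroup.archFormOf,
        Matrix.map_one (mixedEmbedding L) (map_zero _) (map_one _), Matrix.mul_one] at h1
      have h0 : ((GLn.toMixed n L k : GL (Fin n) (mixedSpace L)) : Matrix (Fin n) (Fin n) (mixedSpace L)) =
          (k : Matrix (Fin n) (Fin n) (AdeleRing (𝓞 L) L)).map φ := Matrix.ext fun i j => rfl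
      rwa [h0] at h1
    have hwwφ : wf.map φ * wf.map φ = 1 := by rw [← Matrix.map_mul, hwwf, Matrix.map_one φ (map_zero φ) (map_one φ)]
    have hwTφ : (wf.map φ)ᵀ = wf.map φ := by rw [← Matrix.transpose_map, hwfT]
    have hwτφ : (wf.map φ).map (UnitaryGroup.conjMixed (Fp L) L (IsCMField.complexConj L)) = wf.map φ := by rw [hconj, hwfσ]
    have hGφ : ((GLn.toMixed (n + n) L (SA⁻¹ * adelicVal (Fp L) L (IsCMField.complexConj L) (n + n) (hermD L e dV hdV dW hdW) (Λ k) * SA) :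
          GL (Fin (n + n)) (mixedSpace L)) : Matrix (Fin (n + n)) (Fin (n + n)) (mixedSpace L)) =
        Matrix.reindex (e₂ (n := n)) (e₂ (n := n))
          (Matrix.fromBlocks ((k : Matrix (Fin n) (Fin n) (AdeleRing (𝓞 L) L)).map φ) 0 0
            (wf.map φ * ((((k⁻¹ : GL (Fin n) (AdeleRing (𝓞 L) L)) : Matrix (Fin n) (Fin n) (AdeleRing (𝓞 L) L)).map φ).map
              (UnitaryGroup.conjMixed (Fp L) L (IsCMField.complexConj L)))ᵀ * wf.map φ)) := by
      have h0 : ((GLn.toMixed (n + n) L (SA⁻¹ * adelicVal (Fp L) L (IsCMField.complexConj L) (n + n) (hermD L e dV hdV dW hdW) (Λ k) * SA) :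
            GL (Fin (n + n)) (mixedSpace L)) : Matrix (Fin (n + n)) (Fin (n + n)) (mixedSpace L)) =
          ((SA⁻¹ * adelicVal (Fp L) L (IsCMField.complexConj L) (n + n) (hermD L e dV hdV dW hdW) (Λ k) * SA :
            GL (Fin (n + n)) (AdeleRing (𝓞 L) L)) : Matrix (Fin (n + n)) (Fin (n + n)) (AdeleRing (𝓞 L) L)).map φ :=
        Matrix.ext fun i j => rfl
      rw [h0, hGmat k, hconj, Matrix.reindex_apply, Matrix.reindex_apply, ← Matrix.submatrix_map, Matrix.fromBlocks_map,
        Matrix.map_zero φ (map_zero φ), Matrix.map_mul, Matrix.map_mul, Matrix.transpose_map]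
    rw [mem_Kinf_iff_mem_arch_one (Fp L) (IsCMField.complexConj L) hc1 hfix1, mem_arch_iff, UnitaryGroup.archFormOf,
      Matrix.map_one (mixedEmbedding L) (map_zero _) (map_one _), Matrix.mul_one, hGφ]
    exact transpose_map_mul_reindex_eq_one _ _ _
      (unitary_leviBlock (UnitaryGroup.conjMixed (Fp L) L (IsCMField.complexConj L)) hτ _ _ _ hk1 hU hwwφ hwTφ hwτφ)
  · -- FINITE PLACES: entries of `S⁻¹ Λ(k′) S` and of its inverse `S⁻¹ Λ(k′⁻¹) S` are integral
    have hwint : ∀ i j, ((wf.map (adeleSnd L)) i j) ∈ integralFiniteAdeles L := by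
      intro i j
      rw [Matrix.map_apply, hwfdef, Matrix.map_apply, hwdef, antidiagonal_over_apply]
      split_ifs
      · rw [map_one, map_one]
        exact (integralFiniteAdeles L).one_mem
      · rw [map_zero, map_zero]
        exact (integralFiniteAdeles L).zero_mem
    have hint : ∀ k' : GL (Fin n) (AdeleRing (𝓞 L) L), k' ∈ standardMaximalCompactGL n L → ∀ i j,
        (((SA⁻¹ * adelicVal (Fp L) L (IsCMField.complexConj L) (n + n) (hermD L e dV hdV dW hdW) (Λ k') * SA :
          GL (Fin (n + n)) (AdeleRing (𝓞 L) L)) : Matrix (Fin (n + n)) (Fin (n + n)) (AdeleRing (𝓞 L) L)).map (adeleSnd L)) i j ∈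
          integralFiniteAdeles L := by
      intro k' hk' i j
      have h2 := ((mem_standardMaximalCompactGL_iff_toMixed_sndHom k').1 hk').2
      rw [mem_glFiniteIntegralLevel_iff, ← map_inv] at h2
      rw [hGmat k', Matrix.reindex_apply, ← Matrix.submatrix_map, Matrix.fromBlocks_map, Matrix.map_zero _ (map_zero _),
        Matrix.map_mul, Matrix.map_mul, Matrix.transpose_map, ← Matrix.reindex_apply]
      refine reindex_fromBlocks_apply_mem (integralFiniteAdeles L) (e₂ (n := n)) (fun i j => h2.1 i j) ?_ i j
      refine mul_transpose_mul_apply_mem (integralFiniteAdeles L) hwint (fun i j => ?_)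
      rw [Matrix.map_apply, Matrix.map_apply, hσdef]
      exact conjFiniteAdele_mem_integralFiniteAdeles (Fp L) (IsCMField.complexConj L) (h2.2 i j)
    have hVinv : adelicVal (Fp L) L (IsCMField.complexConj L) (n + n) (hermD L e dV hdV dW hdW) (Λ k⁻¹) =
        (adelicVal (Fp L) L (IsCMField.complexConj L) (n + n) (hermD L e dV hdV dW hdW) (Λ k))⁻¹ := by
      show ((Λ k⁻¹ : HA L e dV hdV dW hdW) : GL (Fin (n + n)) (AdeleRing (𝓞 L) L)) =
        ((Λ k : HA L e dV hdV dW hdW) : GL (Fin (n + n)) (AdeleRing (𝓞 L) L))⁻¹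
      rw [map_inv, Subgroup.coe_inv]
    have hGinv : (SA⁻¹ * adelicVal (Fp L) L (IsCMField.complexConj L) (n + n) (hermD L e dV hdV dW hdW) (Λ k) * SA)⁻¹ =
        SA⁻¹ * adelicVal (Fp L) L (IsCMField.complexConj L) (n + n) (hermD L e dV hdV dW hdW) (Λ k⁻¹) * SA := by
      rw [hVinv, mul_inv_rev, mul_inv_rev, inv_inv, mul_assoc]
    rw [mem_glFiniteIntegralLevel_iff, ← map_inv, hGinv]
    exact ⟨fun i j => hint k hk i j, fun i j => hint k⁻¹ ((standardMaximalCompactGL n L).inv_mem hk) i j⟩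

/-- **THE ARCHIMEDEAN HALF, IN THE END'S CURRENCY**: with `𝒦` as above, for `k ∈ K_{GL_n}` both `Λ k ∈ 𝒦.K` and `(Λ(k)_∞, 1) ∈ 𝒦.K` (★ `archEmb_archPart_mem`,
(P0) of `IsStd`) — i.e. `Λ(K_∞) ⊆ (K₉)_∞`, the letter `continuation_of_archReference (𝒦₁ := K₉)` (K2Liu-p25) and the open–finite-index level
`KG := Λ⁻¹(𝒦.K) ⊓ K_{GL₂}` of ★ I4 ED. 5 need at the reference datum. [cite: BorelJacquet1979, §4.1] [cite: Tan1999, §1 p. 166] -/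
theorem exists_isStd_leviAdapted_arch (hdV0 : ∀ i, dV i ≠ 0) (hdW0 : ∀ i, dW i ≠ 0) :
    ∃ 𝒦 : IwasawaDatum L e dV hdV dW hdW, 𝒦.IsStd ∧
      ∀ (Λ : GL (Fin n) (AdeleRing (𝓞 L) L) →* HA L e dV hdV dW hdW)
        (_hΛ : ∀ g : GL (Fin n) (AdeleRing (𝓞 L) L), blk L e dV hdV dW hdW (Λ g) =
          cayR (AdeleRing (𝓞 L) L) (Fin n) * Matrix.fromBlocks (g : Matrix (Fin n) (Fin n) (AdeleRing (𝓞 L) L)) 0 0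
            (((gramR L e dV hdV dW hdW).map ((algebraMap L (AdeleRing (𝓞 L) L)).comp (algebraMap (Fp L) L)))⁻¹ *
              (((g⁻¹ : GL (Fin n) (AdeleRing (𝓞 L) L)) : Matrix (Fin n) (Fin n) (AdeleRing (𝓞 L) L)).map
                (conjAdele (Fp L) L (IsCMField.complexConj L)))ᵀ *
              (gramR L e dV hdV dW hdW).map ((algebraMap L (AdeleRing (𝓞 L) L)).comp (algebraMap (Fp L) L))) *
            cayRinv (AdeleRing (𝓞 L) L) (Fin n))
        (k : GL (Fin n) (AdeleRing (𝓞 L) L)), k ∈ standardMaximalCompactGL n L →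
        Λ k ∈ 𝒦.K ∧
          (archToAdelic (Fp L) L (IsCMField.complexConj L) (n + n) (hermD L e dV hdV dW hdW)
            (archPart (Fp L) L (IsCMField.complexConj L) (n + n) (hermD L e dV hdV dW hdW) (Λ k)) : HA L e dV hdV dW hdW) ∈ 𝒦.K := by
  obtain ⟨𝒦, h𝒦, hΛK⟩ := exists_isStd_leviAdapted L e dV hdV dW hdW hdV0 hdW0
  refine ⟨𝒦, h𝒦, fun Λ hΛ k hk => ⟨hΛK Λ hΛ k hk, ?_⟩⟩
  have h := archEmb_archPart_mem h𝒦 (hΛK Λ hΛ k hk)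
  rwa [archEmb_eq_archToAdelic] at h

end Transport

end Summit.HodgeConjecture.HodgeConjecture.Cruxes.HLiu418.K2LiuLeviChartArchCompactOfRecord

end
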